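import Mathlib.Combinatorics.SimpleGraph.Connectivity.Connected
import Mathlib.Topology.MetricSpace.Basic
import Mathlib.Order.Nat
import HarnessLib

/-!
# Crux `ClusterSetConnected`, line `registered` — chain bookkeeping for `stub_sandwichLowerOfWalks`

Elementary lemmas about finite chains `f 0, f 1, …` indexed by `ℕ`, used by the lower half of the
sandwich (`quadCrossing (tall-narrow perturbation) ⊆ discreteCrossing`): selecting, along a chain of
lattice edges that starts with a "low-bad" edge and ends with a "high-bad" edge, a maximal run of
good edges from a low-bad edge to a high-bad edge (`exists_good_run`); a discrete intermediate
value lemma (`exists_first_ge`); reachability along a chain of adjacent vertices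
(`reachable_of_chain`). Pure combinatorics, no geometry.
-/

namespace Summit.CriticalPhenomena.CardyFormulaZ2.Theorems.ClusterSetConnected

/-- **Selecting the crossing run.** Along edges `0, …, n` classified as `good`, `low` or `high`
(every non-good edge is low or high, never both), if edge `0` is non-good and low, edge `n` is
non-good and high, and a low non-good edge is never immediately followed by a high non-good edge,
then there are indices `k₁ + 1 < k₂ ≤ n` with edge `k₁` non-good and low, edge `k₂` non-good and
high, and all edges strictly between them good. (`k₂` = first high non-good edge, `k₁` = last low
non-good edge before it.) -/
theorem exists_good_run {n : ℕ} {good low high : ℕ → Prop}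
    (hcases : ∀ j ≤ n, ¬ good j → low j ∨ high j) (hexcl : ∀ j ≤ n, ¬ (low j ∧ high j))
    (h0 : ¬ good 0 ∧ low 0) (hn : ¬ good n ∧ high n)
    (hadj : ∀ j < n, ¬ good j → low j → ¬ good (j + 1) → high (j + 1) → False) :
    ∃ k₁ k₂ : ℕ, k₁ + 1 < k₂ ∧ k₂ ≤ n ∧ (¬ good k₁ ∧ low k₁) ∧ (¬ good k₂ ∧ high k₂) ∧
      ∀ m, k₁ < m → m < k₂ → good m := by
  classical
  -- `k₂`: the first high non-good edge
  have hex₂ : ∃ m, m ≤ n ∧ ¬ good m ∧ high m := ⟨n, le_rfl, hn.1, hn.2⟩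
  set k₂ := Nat.find hex₂ with hk₂
  obtain ⟨hk₂n, hk₂g, hk₂h⟩ : k₂ ≤ n ∧ ¬ good k₂ ∧ high k₂ := Nat.find_spec hex₂
  have hmin₂ : ∀ m < k₂, ¬ good m → ¬ high m := fun m hm hgm hhm =>
    (Nat.find_min hex₂ (m := m) hm) ⟨(le_of_lt hm).trans hk₂n, hgm, hhm⟩
  -- `k₂ ≠ 0`: edge `0` is low, hence not high
  have hk₂0 : k₂ ≠ 0 := by
    intro h
    exact hexcl 0 (Nat.zero_le _) ⟨h0.2, h ▸ hk₂h⟩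
  -- `k₁`: the last low non-good edge before `k₂`
  set k₁ := Nat.findGreatest (fun m => ¬ good m ∧ low m) (k₂ - 1) with hk₁
  have hk₁spec : ¬ good k₁ ∧ low k₁ :=
    Nat.findGreatest_spec (P := fun m => ¬ good m ∧ low m) (Nat.zero_le (k₂ - 1)) h0
  have hk₁le : k₁ ≤ k₂ - 1 := Nat.findGreatest_le (k₂ - 1)
  have hk₁lt : k₁ < k₂ := by omega
  have hmax₁ : ∀ m, k₁ < m → m ≤ k₂ - 1 → ¬ (¬ good m ∧ low m) := fun m hm hm' =>
    Nat.findGreatest_is_greatest hm hm'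
  -- edges strictly between are good
  have hgood : ∀ m, k₁ < m → m < k₂ → good m := by
    intro m hm₁ hm₂
    by_contra hgm
    have hml : ¬ low m := fun hl => hmax₁ m hm₁ (by omega) ⟨hgm, hl⟩
    have hmh : ¬ high m := hmin₂ m hm₂ hgm
    rcases hcases m ((le_of_lt hm₂).trans hk₂n) hgm with h | h
    · exact hml h
    · exact hmh h
  -- `k₁ + 1 < k₂`: a low non-good edge is not followed by a high non-good one
  have hsep : k₁ + 1 < k₂ := by
    rcases Nat.lt_or_ge (k₁ + 1) k₂ with h | h
    · exact h
    · exfalso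
      have heq : k₁ + 1 = k₂ := by omega
      exact hadj k₁ (by omega) hk₁spec.1 hk₁spec.2 (heq ▸ hk₂g) (heq ▸ hk₂h)
  exact ⟨k₁, k₂, hsep, hk₂n, hk₁spec, ⟨hk₂g, hk₂h⟩, hgood⟩

/-- **Discrete intermediate value.** If `g p < c ≤ g q` (`p < q`) and consecutive values differ by
less than `t` on `[p, q)`, then some index `l ∈ (p, q]` has `c ≤ g l < c + t` (the first index at
which `g ≥ c`). -/
theorem exists_first_ge {g : ℕ → ℝ} {p q : ℕ} (hpq : p < q) {c t : ℝ} (hp : g p < c) (hq : c ≤ g q)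
    (hstep : ∀ j, p ≤ j → j < q → g (j + 1) - g j < t) :
    ∃ l, p < l ∧ l ≤ q ∧ c ≤ g l ∧ g l < c + t := by
  classical
  have hex : ∃ l, p < l ∧ l ≤ q ∧ c ≤ g l := ⟨q, hpq, le_rfl, hq⟩
  set l := Nat.find hex with hl
  obtain ⟨hpl, hlq, hcl⟩ : p < l ∧ l ≤ q ∧ c ≤ g l := Nat.find_spec hex
  have hmin : ∀ m < l, ¬ (p < m ∧ m ≤ q ∧ c ≤ g m) := fun m hm => Nat.find_min hex hm
  refine ⟨l, hpl, hlq, hcl, ?_⟩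
  -- the previous index is below `c`
  have hprev : g (l - 1) < c := by
    rcases Nat.lt_or_ge p (l - 1) with h | h
    · by_contra hge
      exact hmin (l - 1) (by omega) ⟨h, by omega, not_lt.1 hge⟩
    · have : l - 1 = p := by omega
      rw [this]; exact hp
  have hst := hstep (l - 1) (by omega) (by omega)
  rw [show l - 1 + 1 = l by omega] at hst
  linarith

/-- **Reachability along a chain.** If `f j ∼ f (j+1)` in `G` for `p ≤ j < q`, then `f p` and
`f q` are joined in `G` (`p ≤ q`). -/
theorem reachable_of_chain {V : Type*} {G : SimpleGraph V} {f : ℕ → V} {p q : ℕ} (hpq : p ≤ q)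
    (hadj : ∀ j, p ≤ j → j < q → G.Adj (f j) (f (j + 1))) : G.Reachable (f p) (f q) := by
  induction q with
  | zero =>
    have : p = 0 := Nat.le_zero.1 hpq
    subst this
    exact SimpleGraph.Reachable.refl _
  | succ q ih =>
    rcases Nat.lt_or_ge p (q + 1) with h | h
    · have hpq' : p ≤ q := Nat.lt_succ_iff.1 h
      exact (ih hpq' fun j hj hjq => hadj j hj (Nat.lt_succ_of_lt hjq)).trans
        (hadj q hpq' (Nat.lt_succ_self q)).reachable
    · have : p = q + 1 := le_antisymm hpq h
      subst this
      exact SimpleGraph.Reachable.refl _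

/-- **Propagation along a chain.** If a property `P` passes along a relation `r` in both
directions, `r (f j) (f (j+1))` for `p ≤ j < q`, and `P (f l)` holds for some `l ∈ [p, q]`, then `P`
holds along the whole chain. -/
theorem forall_of_chain {V : Type*} {r : V → V → Prop} {P : V → Prop}
    (hP : ∀ x y, r x y → P x → P y) (hP' : ∀ x y, r x y → P y → P x) {f : ℕ → V} {p q : ℕ}
    (hadj : ∀ j, p ≤ j → j < q → r (f j) (f (j + 1))) {l : ℕ} (hpl : p ≤ l) (hlq : l ≤ q)
    (hl : P (f l)) : ∀ j, p ≤ j → j ≤ q → P (f j) := by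
  -- upwards from `l`
  have hup : ∀ d, l + d ≤ q → P (f (l + d)) := by
    intro d
    induction d with
    | zero => intro _; simpa using hl
    | succ d ih =>
      intro hd
      have h := hadj (l + d) (by omega) (by omega)
      rw [show l + (d + 1) = l + d + 1 by omega]
      exact hP _ _ h (ih (by omega))
  -- downwards from `l`
  have hdown : ∀ d, d ≤ l - p → P (f (l - d)) := by
    intro d
    induction d with
    | zero => intro _; simpa using hl
    | succ d ih =>
      intro hd
      have h := hadj (l - (d + 1)) (by omega) (by omega)
      rw [show l - (d + 1) + 1 = l - d by omega] at h
      exact hP' _ _ h (ih (by omega))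
  intro j hpj hjq
  rcases Nat.lt_or_ge j l with h | h
  · have := hdown (l - j) (by omega)
    rwa [show l - (l - j) = j by omega] at this
  · have := hup (j - l) (by omega)
    rwa [show l + (j - l) = j by omega] at this

/-- **Registered one-line form `stub_sandwichLowerChains`** (S1a-C) of `exists_good_run`, so that
this helper file rides with the line. -/
theorem stub_sandwichLowerChains :
    ∀ (n : ℕ) (good low high : ℕ → Prop), (∀ j ≤ n, ¬ good j → low j ∨ high j) →
      (∀ j ≤ n, ¬ (low j ∧ high j)) → (¬ good 0 ∧ low 0) → (¬ good n ∧ high n) →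
      (∀ j < n, ¬ good j → low j → ¬ good (j + 1) → high (j + 1) → False) →
      ∃ k₁ k₂ : ℕ, k₁ + 1 < k₂ ∧ k₂ ≤ n ∧ (¬ good k₁ ∧ low k₁) ∧ (¬ good k₂ ∧ high k₂) ∧
        ∀ m, k₁ < m → m < k₂ → good m :=
  fun _ _ _ _ h1 h2 h3 h4 h5 => exists_good_run h1 h2 h3 h4 h5

end Summit.CriticalPhenomena.CardyFormulaZ2.Theorems.ClusterSetConnected
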